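import Summits.ABC.IUTFork.Joshi.ATS4DescentInputsCalibration
import HarnessLib

/-!
# [J-IV] (arXiv:2403.10430v2) §6.8–§6.12 ⟶ §7: the EIGHT non-idle named descent inputs on the free glued carrier form an
# IRREDUNDANT core — each of their proper sub-conjunctions is satisfiable at EVERY Thm-6.1.1 datum (census bookkeeping for the E5 spine)

Proof-only companion (0 defs) of the abc-iut cell, branch E / R-J «Joshi Y-discharge census» (rung LADDER-ABC:A2.RESCUE.J; seat
abc-iut-E-t21 gen 8; census row Y-21 of `HOME/plan/E/R-J/Y-CENSUS.tsv`). Sequel BY NAME of abc-iut-E-t35's calibration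
`Joshi/ATS4DescentInputsCalibration.lean` (p446138): nothing of it is restated. SOURCE: K. Joshi, *Construction of Arithmetic
Teichmüller Spaces IV*, arXiv:2403.10430v2 (unrefereed; bib `Joshi2024ATS4`), Thm. 6.1.1 p.58 l.1–23, Lemma 6.7.8 p.62 l.22–27,
(6.8.11) p.64 l.2–3, Prop. 6.10.9 p.69 l.1–28, Thm. 6.10.1 p.66 l.12–61, (6.11.1) p.69 l.73 – p.70 l.3, (6.11.7) p.71 l.89–110;
page/line = the cell's render `HOME/lit/renders/Joshi-arxiv-2403.10430/`.

FRAMING (binding): statements about OUR typing of a third party's unrefereed text — which conjunctions of the typed reading predicates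
have content on the carrier the E5 spine quantifies over. NO side is taken on [IUTchIII] Cor. 3.12 / [IUTchIV] Thm. 1.10, on Joshi's
claims, or on Mochizuki's report on them; NOT a test verdict; NO abc claim. Typed ≠ proved ≠ endorsed.

WHAT WAS KNOWN (p446138). In the E5 spines `abc_of_thetaTowerDescentInputs` (p443293), `abc_of_descentInputsAtThetaDivision` /
`abc_of_descentInputs_exists` (p446286 / p447878) the consumer must return, per point, a carrier `dd : LocusVolumeDatum` tied to the
Thm-6.1.1 datum `M : MainBoundDatum` ONLY through `MainBoundGlue` (eight equalities `ℓ, d_mod, e*_mod, η_prm = 60, log d_{L_tpd},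
log f_{L_tpd}, log d_{L′}, log q`) and satisfying the nine NAMED §6.8–§6.11 inputs: (6.11.1) `Eq6111`, Prop. 6.10.9 on `V^dst` `Prop6109`,
`ComponentSums`, (6.8.11) `Eq6811`, Lemma 6.7.8 `Lem678`, the LOWER BOUND `LowerBound` (= [J-III] Cor. 9.11.1.1 at `φ(y₀)`),
`FrobShiftQ`, `FrobShiftVol`, «(1/2ℓ) log q = |log q_ℓ|» `LogqDictionary`. E-t35 PROVED `MainBoundDatum.exists_glue_inputs_iff`: this
`∃ dd` block ⟺ ONE explicit inequality (E) at `M`, and `FrobShiftQ` is idle.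

WHAT IS ADDED HERE (all PROVED; explicit witnesses, real arithmetic only).
1. IRREDUNDANCE (§2): for EACH of the eight non-idle inputs `R`, the complement «`MainBoundGlue` ∧ the other eight inputs» is
   SATISFIABLE AT EVERY `M : MainBoundDatum` (`exists_glue_inputs_erase_<R>` ×8). Each witness is the glued carrier with ONE
   distinguished prime and all volumes zero, perturbed in at most three unglued slots (a hull log-volume `−ℓ*·((ℓ+1)/4)·(log q)/6`,
   or `log s_ℚ := ℓ·log q`, or `log s^≤ := (log q)/e*_mod`, or `|log q_ℓ| := (volume)/ℓ* + 1`, or zero components). So on the free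
   glued carrier NO proper sub-conjunction of the eight has content: the content of the block is JOINT and equals (E); no single
   letter is decidable on its own there — each is met by a choice of the unglued slots.
2. CONTENT IS NON-VOID over the signature (§3): an explicit `MainBoundDatum` (`ℓ = 5`, `d_mod = e_mod = 1`, all log-degrees `0`,
   `log q = 10⁹`) at which (E) FAILS (`exists_mainBoundDatum_not_ineqE`), hence at which the nine-input block is UNSATISFIABLE
   (`exists_mainBoundDatum_not_glue_inputs`, by p446138) while — by §2 — every eight-input sub-block is satisfiable.
RUNG CURRENCY (A2.RESCUE.J, row Y-21 «11 rows to split»): at the ∃-form spines the split into letters is NOT a split of content —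
the eight letters above are an irredundant core with joint content (E) (Szpiro-shaped in the seven glued numbers); `FrobShiftQ` idle
(p446138); `MainBoundGlue` definitional (met by copying `M`'s numbers); `IsLem587Prime` is a ∀-GIVEN of p447878 and a theorem of the
tree (`exists_isLem587Prime`). Per-letter rows are well-posed only at NAMED GENUINE GLUES of the unglued slots (`TowerGlue`, the
global-normalisation supply of `LogqDictionary`, `DescentGlue`), untouched here. Theorems only; standard axioms; no `sorry`, instance,
notation, `def` or new `Prop`. [claim: Joshi2024ATS4, status: disputed]. (v2, doc-only: title says «EIGHT non-idle», since the
sub-conjunction dropping only the idle `FrobShiftQ` is proper yet equivalent to the full block — abc-iut-E-cx-2 precision note.)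
-/

noncomputable section

namespace Summit.ABC.IUTFork.Joshi.ATS4

namespace MainBoundDatum

variable (M : MainBoundDatum)

/-! ## 1. The inequalities every witness uses -/

/-- The numeric facts about a Thm-6.1.1 datum used by every witness below: `ℓ ≥ 5`, `log q > 0`, `e*_mod ≥ 2¹²·3³·5`,
`log(2·3·5·ℓ) ≥ 0`, `log d_{L′} ≥ 0`, `log d_{L_tpd} + log f_{L_tpd} ≥ 0`, `η_prm = 60 ≥ 0`. [folklore] -/
private theorem basics :
    (5 : ℝ) ≤ M.ell ∧ 0 < M.logq ∧ (552960 : ℝ) ≤ (M.estar : ℝ) ∧ 0 ≤ Real.log (2 * 3 * 5 * (M.ell : ℝ)) ∧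
      0 ≤ M.logDiffLp ∧ 0 ≤ M.logDiffLtpd + M.logCondLtpd ∧ (0 : ℝ) ≤ etaPrm := by
  have hl5 : (5 : ℝ) ≤ M.ell := M.five_le_ell_real
  have hest : (552960 : ℝ) ≤ (M.estar : ℝ) := by
    have h1 : (1 : ℝ) ≤ M.emod := by exact_mod_cast M.one_le_emod
    unfold MainBoundDatum.estar; push_cast; nlinarith
  refine ⟨hl5, M.logq_pos, hest, Real.log_nonneg (by linarith), M.logDiffLp_nonneg,
    add_nonneg M.logDiffLtpd_nonneg M.logCondLtpd_nonneg, by unfold etaPrm; norm_num⟩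

/-! ## 2. Irredundance: each of the eight non-idle inputs can be dropped at EVERY datum -/

/-- **Drop Prop. 6.10.9**: at every `M`, the glued carrier with one distinguished prime carrying every component, ALL log-volumes
`0`, `log s_ℚ = log s^≤ = 0`, `|log q_ℓ| := (1/2ℓ)·log q` (both arithmeticoids) satisfies the glue and the other EIGHT inputs
((6.11.1), component sums, (6.8.11), Lemma 6.7.8, the lower bound, both shift equalities, the dictionary). PROVED.
[claim: Joshi2024ATS4, status: disputed] -/
theorem exists_glue_inputs_erase_prop6109 :
    ∃ dd : LocusVolumeDatum, MainBoundGlue M dd ∧ dd.Eq6111 ∧ dd.ComponentSums ∧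
      dd.Eq6811 ∧ dd.Lem678 ∧ dd.LowerBound ∧ dd.FrobShiftQ ∧ dd.FrobShiftVol ∧ dd.LogqDictionary := by
  obtain ⟨hl5, hq, hest, hlog30, hLp, hT, heta⟩ := M.basics
  have hA : 0 < 1 / (2 * (M.ell : ℝ)) * M.logq := by positivity
  refine ⟨{
      l := M.ell, five_le_l := M.five_le_ell, dmod := M.dmod, one_le_dmod := M.one_le_dmod,
      estar := (M.estar : ℝ), estar_ge := hest, eta := etaPrm, eta_nonneg := heta,
      logDiffTpd := M.logDiffLtpd, logDiffTpd_nonneg := M.logDiffLtpd_nonneg,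
      logCondTpd := M.logCondLtpd, logCondTpd_nonneg := M.logCondLtpd_nonneg, logDiffLp := M.logDiffLp,
      logq := M.logq, logq_nonneg := hq.le, logsQ := 0, logsLe := 0, Vdst := {2},
      logDiffLpAt := fun _ => M.logDiffLp, logqAt := fun _ => M.logq, logsQAt := fun _ => 0, logsLeAt := fun _ => 0,
      logVolAt := fun _ => 0, logVolArch := 0, logVolHull := 0, logVolHullFrob := 0,
      absLogThetaQ := 1 / (2 * (M.ell : ℝ)) * M.logq, absLogThetaQ_pos := hA,
      absLogThetaQFrob := 1 / (2 * (M.ell : ℝ)) * M.logq },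
    ⟨rfl, rfl, rfl, rfl, rfl, rfl, rfl, rfl⟩, ?_, ?_, ?_, ?_, ?_, ?_, ?_, ?_⟩
  · unfold LocusVolumeDatum.Eq6111; simp only [Finset.sum_singleton, abs_zero, add_zero]
  · unfold LocusVolumeDatum.ComponentSums; simp only [Finset.sum_singleton, and_self]
  · unfold LocusVolumeDatum.Eq6811; dsimp only; exact add_nonneg (mul_nonneg (by positivity) hT) hlog30
  · unfold LocusVolumeDatum.Lem678; dsimp only; rw [mul_zero]; positivity
  · unfold LocusVolumeDatum.LowerBound; dsimp only; rw [abs_zero, mul_zero]; exact neg_nonpos.mpr (abs_nonneg _)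
  all_goals first | (unfold LocusVolumeDatum.FrobShiftQ; rfl) | (unfold LocusVolumeDatum.FrobShiftVol; rfl) |
    (unfold LocusVolumeDatum.LogqDictionary; rfl)

/-- **Drop the component sums**: at every `M`, the all-zero-volume glued carrier whose distinguished prime carries ZERO components
(`log d_{L′,2} = log q_2 = log s_{ℚ,2} = log s^≤_2 = 0`) satisfies the glue and the other eight inputs — Prop. 6.10.9 at the prime reads
`0 ≤ 0`. PROVED. [claim: Joshi2024ATS4, status: disputed] -/
theorem exists_glue_inputs_erase_componentSums :
    ∃ dd : LocusVolumeDatum, MainBoundGlue M dd ∧ dd.Eq6111 ∧ (∀ p ∈ dd.Vdst, dd.Prop6109 p) ∧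
      dd.Eq6811 ∧ dd.Lem678 ∧ dd.LowerBound ∧ dd.FrobShiftQ ∧ dd.FrobShiftVol ∧ dd.LogqDictionary := by
  obtain ⟨hl5, hq, hest, hlog30, hLp, hT, heta⟩ := M.basics
  have hA : 0 < 1 / (2 * (M.ell : ℝ)) * M.logq := by positivity
  refine ⟨{
      l := M.ell, five_le_l := M.five_le_ell, dmod := M.dmod, one_le_dmod := M.one_le_dmod,
      estar := (M.estar : ℝ), estar_ge := hest, eta := etaPrm, eta_nonneg := heta,
      logDiffTpd := M.logDiffLtpd, logDiffTpd_nonneg := M.logDiffLtpd_nonneg,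
      logCondTpd := M.logCondLtpd, logCondTpd_nonneg := M.logCondLtpd_nonneg, logDiffLp := M.logDiffLp,
      logq := M.logq, logq_nonneg := hq.le, logsQ := 0, logsLe := 0, Vdst := {2},
      logDiffLpAt := fun _ => 0, logqAt := fun _ => 0, logsQAt := fun _ => 0, logsLeAt := fun _ => 0,
      logVolAt := fun _ => 0, logVolArch := 0, logVolHull := 0, logVolHullFrob := 0,
      absLogThetaQ := 1 / (2 * (M.ell : ℝ)) * M.logq, absLogThetaQ_pos := hA,
      absLogThetaQFrob := 1 / (2 * (M.ell : ℝ)) * M.logq },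
    ⟨rfl, rfl, rfl, rfl, rfl, rfl, rfl, rfl⟩, ?_, ?_, ?_, ?_, ?_, ?_, ?_, ?_⟩
  · unfold LocusVolumeDatum.Eq6111; simp only [Finset.sum_singleton, abs_zero, add_zero]
  · intro p _
    unfold LocusVolumeDatum.Prop6109 LocusVolumeDatum.lstar; dsimp only
    simp only [abs_zero, mul_zero, sub_zero, add_zero, le_refl]
  · unfold LocusVolumeDatum.Eq6811; dsimp only; exact add_nonneg (mul_nonneg (by positivity) hT) hlog30
  · unfold LocusVolumeDatum.Lem678; dsimp only; rw [mul_zero]; positivity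
  · unfold LocusVolumeDatum.LowerBound; dsimp only; rw [abs_zero, mul_zero]; exact neg_nonpos.mpr (abs_nonneg _)
  all_goals first | (unfold LocusVolumeDatum.FrobShiftQ; rfl) | (unfold LocusVolumeDatum.FrobShiftVol; rfl) |
    (unfold LocusVolumeDatum.LogqDictionary; rfl)

/-- **Drop (6.8.11)**: at every `M`, the all-zero-volume glued carrier with `log s_ℚ := ℓ·log q` (uncapped; one prime carrying it)
and `log s^≤ = 0` satisfies the glue and the other eight inputs — the `(4/ℓ)·log s_ℚ = 4·log q` term makes Prop. 6.10.9 at the prime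
read `0 ≤ ((ℓ+1)/4)·((1 + 4/ℓ)·log d_{L′} + (23/6)·log q)`. PROVED. [claim: Joshi2024ATS4, status: disputed] -/
theorem exists_glue_inputs_erase_eq6811 :
    ∃ dd : LocusVolumeDatum, MainBoundGlue M dd ∧ dd.Eq6111 ∧ (∀ p ∈ dd.Vdst, dd.Prop6109 p) ∧ dd.ComponentSums ∧
      dd.Lem678 ∧ dd.LowerBound ∧ dd.FrobShiftQ ∧ dd.FrobShiftVol ∧ dd.LogqDictionary := by
  obtain ⟨hl5, hq, hest, hlog30, hLp, hT, heta⟩ := M.basics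
  have hl : (0 : ℝ) < M.ell := by linarith
  have hA : 0 < 1 / (2 * (M.ell : ℝ)) * M.logq := by positivity
  refine ⟨{
      l := M.ell, five_le_l := M.five_le_ell, dmod := M.dmod, one_le_dmod := M.one_le_dmod,
      estar := (M.estar : ℝ), estar_ge := hest, eta := etaPrm, eta_nonneg := heta,
      logDiffTpd := M.logDiffLtpd, logDiffTpd_nonneg := M.logDiffLtpd_nonneg,
      logCondTpd := M.logCondLtpd, logCondTpd_nonneg := M.logCondLtpd_nonneg, logDiffLp := M.logDiffLp,
      logq := M.logq, logq_nonneg := hq.le, logsQ := (M.ell : ℝ) * M.logq, logsLe := 0, Vdst := {2},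
      logDiffLpAt := fun _ => M.logDiffLp, logqAt := fun _ => M.logq, logsQAt := fun _ => (M.ell : ℝ) * M.logq,
      logsLeAt := fun _ => 0,
      logVolAt := fun _ => 0, logVolArch := 0, logVolHull := 0, logVolHullFrob := 0,
      absLogThetaQ := 1 / (2 * (M.ell : ℝ)) * M.logq, absLogThetaQ_pos := hA,
      absLogThetaQFrob := 1 / (2 * (M.ell : ℝ)) * M.logq },
    ⟨rfl, rfl, rfl, rfl, rfl, rfl, rfl, rfl⟩, ?_, ?_, ?_, ?_, ?_, ?_, ?_, ?_⟩
  · unfold LocusVolumeDatum.Eq6111; simp only [Finset.sum_singleton, abs_zero, add_zero]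
  · intro p _
    unfold LocusVolumeDatum.Prop6109 LocusVolumeDatum.lstar; dsimp only
    simp only [abs_zero, mul_zero, add_zero]
    have ht : (0 : ℝ) ≤ ((M.ell : ℝ) + 1) / 4 := by positivity
    have hc : 0 ≤ (1 + 4 / (M.ell : ℝ)) * M.logDiffLp := mul_nonneg (by positivity) hLp
    have h4 : 4 / (M.ell : ℝ) * ((M.ell : ℝ) * M.logq) = 4 * M.logq := by field_simp
    rw [h4]
    exact mul_nonneg ht (by linarith)
  · unfold LocusVolumeDatum.ComponentSums; simp only [Finset.sum_singleton, and_self]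
  · unfold LocusVolumeDatum.Lem678; dsimp only; rw [mul_zero]; positivity
  · unfold LocusVolumeDatum.LowerBound; dsimp only; rw [abs_zero, mul_zero]; exact neg_nonpos.mpr (abs_nonneg _)
  all_goals first | (unfold LocusVolumeDatum.FrobShiftQ; rfl) | (unfold LocusVolumeDatum.FrobShiftVol; rfl) |
    (unfold LocusVolumeDatum.LogqDictionary; rfl)

/-- **Drop Lemma 6.7.8**: at every `M`, the all-zero-volume glued carrier with `log s^≤ := (log q)/e*_mod` (uncapped; one prime
carrying it) and `log s_ℚ = 0` satisfies the glue and the other eight inputs — the `(20/3)·e*_mod·log s^≤ = (20/3)·log q` term makes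
Prop. 6.10.9 at the prime read `0 ≤ ((ℓ+1)/4)·((1 + 4/ℓ)·log d_{L′} + (13/2)·log q)`. PROVED. [claim: Joshi2024ATS4, status: disputed] -/
theorem exists_glue_inputs_erase_lem678 :
    ∃ dd : LocusVolumeDatum, MainBoundGlue M dd ∧ dd.Eq6111 ∧ (∀ p ∈ dd.Vdst, dd.Prop6109 p) ∧ dd.ComponentSums ∧
      dd.Eq6811 ∧ dd.LowerBound ∧ dd.FrobShiftQ ∧ dd.FrobShiftVol ∧ dd.LogqDictionary := by
  obtain ⟨hl5, hq, hest, hlog30, hLp, hT, heta⟩ := M.basics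
  have hl : (0 : ℝ) < M.ell := by linarith
  have he : (0 : ℝ) < (M.estar : ℝ) := by linarith
  have hA : 0 < 1 / (2 * (M.ell : ℝ)) * M.logq := by positivity
  refine ⟨{
      l := M.ell, five_le_l := M.five_le_ell, dmod := M.dmod, one_le_dmod := M.one_le_dmod,
      estar := (M.estar : ℝ), estar_ge := hest, eta := etaPrm, eta_nonneg := heta,
      logDiffTpd := M.logDiffLtpd, logDiffTpd_nonneg := M.logDiffLtpd_nonneg,
      logCondTpd := M.logCondLtpd, logCondTpd_nonneg := M.logCondLtpd_nonneg, logDiffLp := M.logDiffLp,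
      logq := M.logq, logq_nonneg := hq.le, logsQ := 0, logsLe := M.logq / (M.estar : ℝ), Vdst := {2},
      logDiffLpAt := fun _ => M.logDiffLp, logqAt := fun _ => M.logq, logsQAt := fun _ => 0,
      logsLeAt := fun _ => M.logq / (M.estar : ℝ),
      logVolAt := fun _ => 0, logVolArch := 0, logVolHull := 0, logVolHullFrob := 0,
      absLogThetaQ := 1 / (2 * (M.ell : ℝ)) * M.logq, absLogThetaQ_pos := hA,
      absLogThetaQFrob := 1 / (2 * (M.ell : ℝ)) * M.logq },
    ⟨rfl, rfl, rfl, rfl, rfl, rfl, rfl, rfl⟩, ?_, ?_, ?_, ?_, ?_, ?_, ?_, ?_⟩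
  · unfold LocusVolumeDatum.Eq6111; simp only [Finset.sum_singleton, abs_zero, add_zero]
  · intro p _
    unfold LocusVolumeDatum.Prop6109 LocusVolumeDatum.lstar; dsimp only
    simp only [abs_zero, mul_zero, add_zero]
    have ht : (0 : ℝ) ≤ ((M.ell : ℝ) + 1) / 4 := by positivity
    have hc : 0 ≤ (1 + 4 / (M.ell : ℝ)) * M.logDiffLp := mul_nonneg (by positivity) hLp
    have h20 : 20 / 3 * (M.estar : ℝ) * (M.logq / (M.estar : ℝ)) = 20 / 3 * M.logq := by field_simp
    rw [h20]
    exact mul_nonneg ht (by linarith)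
  · unfold LocusVolumeDatum.ComponentSums; simp only [Finset.sum_singleton, and_self]
  · unfold LocusVolumeDatum.Eq6811; dsimp only; exact add_nonneg (mul_nonneg (by positivity) hT) hlog30
  · unfold LocusVolumeDatum.LowerBound; dsimp only; rw [abs_zero, mul_zero]; exact neg_nonpos.mpr (abs_nonneg _)
  all_goals first | (unfold LocusVolumeDatum.FrobShiftQ; rfl) | (unfold LocusVolumeDatum.FrobShiftVol; rfl) |
    (unfold LocusVolumeDatum.LogqDictionary; rfl)

/-- The hull log-volume used by the four remaining witnesses: `V := ℓ*·((ℓ+1)/4)·((1/6)·log q) ≥ 0`, chosen so that Prop. 6.10.9 at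
the one distinguished prime with `log Vol := −V` and `log s_ℚ = log s^≤ = 0` reads `0 ≤ ((ℓ+1)/4)·(1 + 4/ℓ)·log d_{L′}`. [folklore] -/
private theorem prop6109_of_vol :
    0 ≤ ((M.ell : ℝ) - 1) / 2 * (((M.ell : ℝ) + 1) / 4 * (1 / 6 * M.logq)) ∧
    -(1 / (((M.ell : ℝ) - 1) / 2)) * |-(((M.ell : ℝ) - 1) / 2 * (((M.ell : ℝ) + 1) / 4 * (1 / 6 * M.logq)))| ≤
      ((M.ell : ℝ) + 1) / 4 * ((1 + 4 / (M.ell : ℝ)) * M.logDiffLp - 1 / 6 * M.logq + 4 / (M.ell : ℝ) * 0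
        + 20 / 3 * (M.estar : ℝ) * 0) := by
  obtain ⟨hl5, hq, -, -, hLp, -, -⟩ := M.basics
  have hls : (0 : ℝ) < ((M.ell : ℝ) - 1) / 2 := by linarith
  have ht : (0 : ℝ) ≤ ((M.ell : ℝ) + 1) / 4 := by positivity
  have hV : 0 ≤ ((M.ell : ℝ) - 1) / 2 * (((M.ell : ℝ) + 1) / 4 * (1 / 6 * M.logq)) := by positivity
  refine ⟨hV, ?_⟩
  rw [abs_neg, abs_of_nonneg hV]
  simp only [mul_zero, add_zero]
  have hl1 : (M.ell : ℝ) - 1 ≠ 0 := ne_of_gt (by linarith)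
  have e : -(1 / (((M.ell : ℝ) - 1) / 2)) * (((M.ell : ℝ) - 1) / 2 * (((M.ell : ℝ) + 1) / 4 * (1 / 6 * M.logq))) =
      -(((M.ell : ℝ) + 1) / 4 * (1 / 6 * M.logq)) := by
    field_simp
  rw [e]
  have hc : 0 ≤ (1 + 4 / (M.ell : ℝ)) * M.logDiffLp := mul_nonneg (by positivity) hLp
  have expand : ((M.ell : ℝ) + 1) / 4 * ((1 + 4 / (M.ell : ℝ)) * M.logDiffLp - 1 / 6 * M.logq) =
      ((M.ell : ℝ) + 1) / 4 * ((1 + 4 / (M.ell : ℝ)) * M.logDiffLp) - ((M.ell : ℝ) + 1) / 4 * (1 / 6 * M.logq) := by ring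
  rw [expand]
  nlinarith [mul_nonneg ht hc]

/-- **Drop the LOWER BOUND** (Joshi's [J-III] Cor. 9.11.1.1 at `φ(y₀)`): at every `M`, the glued carrier with one distinguished prime,
every hull log-volume slot `:= −ℓ*·((ℓ+1)/4)·(log q)/6` (archimedean `0`), `log s_ℚ = log s^≤ = 0` satisfies the glue and the other eight
inputs — (6.11.1), Prop. 6.10.9, component sums, (6.8.11), Lemma 6.7.8, both shift equalities, the dictionary. PROVED.
[claim: Joshi2024ATS4, status: disputed] -/
theorem exists_glue_inputs_erase_lowerBound :
    ∃ dd : LocusVolumeDatum, MainBoundGlue M dd ∧ dd.Eq6111 ∧ (∀ p ∈ dd.Vdst, dd.Prop6109 p) ∧ dd.ComponentSums ∧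
      dd.Eq6811 ∧ dd.Lem678 ∧ dd.FrobShiftQ ∧ dd.FrobShiftVol ∧ dd.LogqDictionary := by
  obtain ⟨hl5, hq, hest, hlog30, hLp, hT, heta⟩ := M.basics
  obtain ⟨hV, h6109⟩ := M.prop6109_of_vol
  have hA : 0 < 1 / (2 * (M.ell : ℝ)) * M.logq := by positivity
  refine ⟨{
      l := M.ell, five_le_l := M.five_le_ell, dmod := M.dmod, one_le_dmod := M.one_le_dmod,
      estar := (M.estar : ℝ), estar_ge := hest, eta := etaPrm, eta_nonneg := heta,
      logDiffTpd := M.logDiffLtpd, logDiffTpd_nonneg := M.logDiffLtpd_nonneg,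
      logCondTpd := M.logCondLtpd, logCondTpd_nonneg := M.logCondLtpd_nonneg, logDiffLp := M.logDiffLp,
      logq := M.logq, logq_nonneg := hq.le, logsQ := 0, logsLe := 0, Vdst := {2},
      logDiffLpAt := fun _ => M.logDiffLp, logqAt := fun _ => M.logq, logsQAt := fun _ => 0, logsLeAt := fun _ => 0,
      logVolAt := fun _ => -(((M.ell : ℝ) - 1) / 2 * (((M.ell : ℝ) + 1) / 4 * (1 / 6 * M.logq))), logVolArch := 0,
      logVolHull := -(((M.ell : ℝ) - 1) / 2 * (((M.ell : ℝ) + 1) / 4 * (1 / 6 * M.logq))),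
      logVolHullFrob := -(((M.ell : ℝ) - 1) / 2 * (((M.ell : ℝ) + 1) / 4 * (1 / 6 * M.logq))),
      absLogThetaQ := 1 / (2 * (M.ell : ℝ)) * M.logq, absLogThetaQ_pos := hA,
      absLogThetaQFrob := 1 / (2 * (M.ell : ℝ)) * M.logq },
    ⟨rfl, rfl, rfl, rfl, rfl, rfl, rfl, rfl⟩, ?_, ?_, ?_, ?_, ?_, ?_, ?_, ?_⟩
  · unfold LocusVolumeDatum.Eq6111; simp only [Finset.sum_singleton, abs_zero, add_zero]
  · intro p _
    unfold LocusVolumeDatum.Prop6109 LocusVolumeDatum.lstar; dsimp only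
    exact h6109
  · unfold LocusVolumeDatum.ComponentSums; simp only [Finset.sum_singleton, and_self]
  · unfold LocusVolumeDatum.Eq6811; dsimp only; exact add_nonneg (mul_nonneg (by positivity) hT) hlog30
  · unfold LocusVolumeDatum.Lem678; dsimp only; rw [mul_zero]; positivity
  all_goals first | (unfold LocusVolumeDatum.FrobShiftQ; rfl) | (unfold LocusVolumeDatum.FrobShiftVol; rfl) |
    (unfold LocusVolumeDatum.LogqDictionary; rfl)

/-- **Drop (6.11.1)**: at every `M`, the glued carrier with the local log-volume at the one distinguished prime
`:= −ℓ*·((ℓ+1)/4)·(log q)/6` but BOTH global hull log-volumes `:= 0` (so the lower bound holds and (6.11.1) is not asked),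
`log s_ℚ = log s^≤ = 0`, satisfies the glue and the other eight inputs. PROVED. [claim: Joshi2024ATS4, status: disputed] -/
theorem exists_glue_inputs_erase_eq6111 :
    ∃ dd : LocusVolumeDatum, MainBoundGlue M dd ∧ (∀ p ∈ dd.Vdst, dd.Prop6109 p) ∧ dd.ComponentSums ∧
      dd.Eq6811 ∧ dd.Lem678 ∧ dd.LowerBound ∧ dd.FrobShiftQ ∧ dd.FrobShiftVol ∧ dd.LogqDictionary := by
  obtain ⟨hl5, hq, hest, hlog30, hLp, hT, heta⟩ := M.basics
  obtain ⟨hV, h6109⟩ := M.prop6109_of_vol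
  have hA : 0 < 1 / (2 * (M.ell : ℝ)) * M.logq := by positivity
  refine ⟨{
      l := M.ell, five_le_l := M.five_le_ell, dmod := M.dmod, one_le_dmod := M.one_le_dmod,
      estar := (M.estar : ℝ), estar_ge := hest, eta := etaPrm, eta_nonneg := heta,
      logDiffTpd := M.logDiffLtpd, logDiffTpd_nonneg := M.logDiffLtpd_nonneg,
      logCondTpd := M.logCondLtpd, logCondTpd_nonneg := M.logCondLtpd_nonneg, logDiffLp := M.logDiffLp,
      logq := M.logq, logq_nonneg := hq.le, logsQ := 0, logsLe := 0, Vdst := {2},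
      logDiffLpAt := fun _ => M.logDiffLp, logqAt := fun _ => M.logq, logsQAt := fun _ => 0, logsLeAt := fun _ => 0,
      logVolAt := fun _ => -(((M.ell : ℝ) - 1) / 2 * (((M.ell : ℝ) + 1) / 4 * (1 / 6 * M.logq))), logVolArch := 0,
      logVolHull := 0, logVolHullFrob := 0,
      absLogThetaQ := 1 / (2 * (M.ell : ℝ)) * M.logq, absLogThetaQ_pos := hA,
      absLogThetaQFrob := 1 / (2 * (M.ell : ℝ)) * M.logq },
    ⟨rfl, rfl, rfl, rfl, rfl, rfl, rfl, rfl⟩, ?_, ?_, ?_, ?_, ?_, ?_, ?_, ?_⟩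
  · intro p _
    unfold LocusVolumeDatum.Prop6109 LocusVolumeDatum.lstar; dsimp only
    exact h6109
  · unfold LocusVolumeDatum.ComponentSums; simp only [Finset.sum_singleton, and_self]
  · unfold LocusVolumeDatum.Eq6811; dsimp only; exact add_nonneg (mul_nonneg (by positivity) hT) hlog30
  · unfold LocusVolumeDatum.Lem678; dsimp only; rw [mul_zero]; positivity
  · unfold LocusVolumeDatum.LowerBound; dsimp only; rw [abs_zero, mul_zero]; exact neg_nonpos.mpr (abs_nonneg _)
  all_goals first | (unfold LocusVolumeDatum.FrobShiftQ; rfl) | (unfold LocusVolumeDatum.FrobShiftVol; rfl) |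
    (unfold LocusVolumeDatum.LogqDictionary; rfl)

/-- **Drop the volume shift equality** `FrobShiftVol`: at every `M`, the glued carrier with the `y₀` hull log-volume (global and at the
one distinguished prime) `:= −ℓ*·((ℓ+1)/4)·(log q)/6` but the `φ(y₀)` hull log-volume `:= 0` (so the lower bound — which reads the
`φ(y₀)` slot — holds), `log s_ℚ = log s^≤ = 0`, satisfies the glue and the other eight inputs. PROVED.
[claim: Joshi2024ATS4, status: disputed] -/
theorem exists_glue_inputs_erase_frobShiftVol :
    ∃ dd : LocusVolumeDatum, MainBoundGlue M dd ∧ dd.Eq6111 ∧ (∀ p ∈ dd.Vdst, dd.Prop6109 p) ∧ dd.ComponentSums ∧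
      dd.Eq6811 ∧ dd.Lem678 ∧ dd.LowerBound ∧ dd.FrobShiftQ ∧ dd.LogqDictionary := by
  obtain ⟨hl5, hq, hest, hlog30, hLp, hT, heta⟩ := M.basics
  obtain ⟨hV, h6109⟩ := M.prop6109_of_vol
  have hA : 0 < 1 / (2 * (M.ell : ℝ)) * M.logq := by positivity
  refine ⟨{
      l := M.ell, five_le_l := M.five_le_ell, dmod := M.dmod, one_le_dmod := M.one_le_dmod,
      estar := (M.estar : ℝ), estar_ge := hest, eta := etaPrm, eta_nonneg := heta,
      logDiffTpd := M.logDiffLtpd, logDiffTpd_nonneg := M.logDiffLtpd_nonneg,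
      logCondTpd := M.logCondLtpd, logCondTpd_nonneg := M.logCondLtpd_nonneg, logDiffLp := M.logDiffLp,
      logq := M.logq, logq_nonneg := hq.le, logsQ := 0, logsLe := 0, Vdst := {2},
      logDiffLpAt := fun _ => M.logDiffLp, logqAt := fun _ => M.logq, logsQAt := fun _ => 0, logsLeAt := fun _ => 0,
      logVolAt := fun _ => -(((M.ell : ℝ) - 1) / 2 * (((M.ell : ℝ) + 1) / 4 * (1 / 6 * M.logq))), logVolArch := 0,
      logVolHull := -(((M.ell : ℝ) - 1) / 2 * (((M.ell : ℝ) + 1) / 4 * (1 / 6 * M.logq))), logVolHullFrob := 0,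
      absLogThetaQ := 1 / (2 * (M.ell : ℝ)) * M.logq, absLogThetaQ_pos := hA,
      absLogThetaQFrob := 1 / (2 * (M.ell : ℝ)) * M.logq },
    ⟨rfl, rfl, rfl, rfl, rfl, rfl, rfl, rfl⟩, ?_, ?_, ?_, ?_, ?_, ?_, ?_, ?_⟩
  · unfold LocusVolumeDatum.Eq6111; simp only [Finset.sum_singleton, abs_zero, add_zero]
  · intro p _
    unfold LocusVolumeDatum.Prop6109 LocusVolumeDatum.lstar; dsimp only
    exact h6109
  · unfold LocusVolumeDatum.ComponentSums; simp only [Finset.sum_singleton, and_self]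
  · unfold LocusVolumeDatum.Eq6811; dsimp only; exact add_nonneg (mul_nonneg (by positivity) hT) hlog30
  · unfold LocusVolumeDatum.Lem678; dsimp only; rw [mul_zero]; positivity
  · unfold LocusVolumeDatum.LowerBound; dsimp only; rw [abs_zero, mul_zero]; exact neg_nonpos.mpr (abs_nonneg _)
  · unfold LocusVolumeDatum.FrobShiftQ; rfl
  · unfold LocusVolumeDatum.LogqDictionary; rfl

/-- **Drop the dictionary** «(1/2ℓ) log q = |log q_ℓ|»: at every `M`, the glued carrier with every hull log-volume slot `:= −V`,
`V = ℓ*·((ℓ+1)/4)·(log q)/6`, and `|log q_ℓ| := V/ℓ* + 1` for BOTH arithmeticoids (so the lower bound `−(V/ℓ* + 1) ≤ −V/ℓ*` holds with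
room `1`), `log s_ℚ = log s^≤ = 0`, satisfies the glue and the other eight inputs. PROVED. [claim: Joshi2024ATS4, status: disputed] -/
theorem exists_glue_inputs_erase_logqDictionary :
    ∃ dd : LocusVolumeDatum, MainBoundGlue M dd ∧ dd.Eq6111 ∧ (∀ p ∈ dd.Vdst, dd.Prop6109 p) ∧ dd.ComponentSums ∧
      dd.Eq6811 ∧ dd.Lem678 ∧ dd.LowerBound ∧ dd.FrobShiftQ ∧ dd.FrobShiftVol := by
  obtain ⟨hl5, hq, hest, hlog30, hLp, hT, heta⟩ := M.basics
  obtain ⟨hV, h6109⟩ := M.prop6109_of_vol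
  have hls : (0 : ℝ) < ((M.ell : ℝ) - 1) / 2 := by linarith
  have hA : 0 < ((M.ell : ℝ) - 1) / 2 * (((M.ell : ℝ) + 1) / 4 * (1 / 6 * M.logq)) / (((M.ell : ℝ) - 1) / 2) + 1 := by
    positivity
  refine ⟨{
      l := M.ell, five_le_l := M.five_le_ell, dmod := M.dmod, one_le_dmod := M.one_le_dmod,
      estar := (M.estar : ℝ), estar_ge := hest, eta := etaPrm, eta_nonneg := heta,
      logDiffTpd := M.logDiffLtpd, logDiffTpd_nonneg := M.logDiffLtpd_nonneg,
      logCondTpd := M.logCondLtpd, logCondTpd_nonneg := M.logCondLtpd_nonneg, logDiffLp := M.logDiffLp,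
      logq := M.logq, logq_nonneg := hq.le, logsQ := 0, logsLe := 0, Vdst := {2},
      logDiffLpAt := fun _ => M.logDiffLp, logqAt := fun _ => M.logq, logsQAt := fun _ => 0, logsLeAt := fun _ => 0,
      logVolAt := fun _ => -(((M.ell : ℝ) - 1) / 2 * (((M.ell : ℝ) + 1) / 4 * (1 / 6 * M.logq))), logVolArch := 0,
      logVolHull := -(((M.ell : ℝ) - 1) / 2 * (((M.ell : ℝ) + 1) / 4 * (1 / 6 * M.logq))),
      logVolHullFrob := -(((M.ell : ℝ) - 1) / 2 * (((M.ell : ℝ) + 1) / 4 * (1 / 6 * M.logq))),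
      absLogThetaQ := ((M.ell : ℝ) - 1) / 2 * (((M.ell : ℝ) + 1) / 4 * (1 / 6 * M.logq)) / (((M.ell : ℝ) - 1) / 2) + 1,
      absLogThetaQ_pos := hA,
      absLogThetaQFrob := ((M.ell : ℝ) - 1) / 2 * (((M.ell : ℝ) + 1) / 4 * (1 / 6 * M.logq)) / (((M.ell : ℝ) - 1) / 2) + 1 },
    ⟨rfl, rfl, rfl, rfl, rfl, rfl, rfl, rfl⟩, ?_, ?_, ?_, ?_, ?_, ?_, ?_, ?_⟩
  · unfold LocusVolumeDatum.Eq6111; simp only [Finset.sum_singleton, abs_zero, add_zero]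
  · intro p _
    unfold LocusVolumeDatum.Prop6109 LocusVolumeDatum.lstar; dsimp only
    exact h6109
  · unfold LocusVolumeDatum.ComponentSums; simp only [Finset.sum_singleton, and_self]
  · unfold LocusVolumeDatum.Eq6811; dsimp only; exact add_nonneg (mul_nonneg (by positivity) hT) hlog30
  · unfold LocusVolumeDatum.Lem678; dsimp only; rw [mul_zero]; positivity
  · unfold LocusVolumeDatum.LowerBound LocusVolumeDatum.lstar; dsimp only
    rw [abs_of_pos hA, abs_neg, abs_of_nonneg hV]
    have e : 1 / (((M.ell : ℝ) - 1) / 2) * (((M.ell : ℝ) - 1) / 2 * (((M.ell : ℝ) + 1) / 4 * (1 / 6 * M.logq))) =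
        ((M.ell : ℝ) - 1) / 2 * (((M.ell : ℝ) + 1) / 4 * (1 / 6 * M.logq)) / (((M.ell : ℝ) - 1) / 2) := by
      field_simp
    rw [neg_mul, e]
    linarith
  · unfold LocusVolumeDatum.FrobShiftQ; rfl
  · unfold LocusVolumeDatum.FrobShiftVol; rfl

/-! ## 3. The content of the block is non-void over the typed signature -/

/-- **An explicit Thm-6.1.1 datum at which (E) fails**: `ℓ = 5`, `d_mod = e_mod = 1` (`e*_mod = 552960`), all log-degrees `0`,
`[L : L_tpd] = [L′ : L] = 1`, `log q = 10⁹`: there (E) reads `10⁸ ≤ (4/5)·log 150 + (80/9)·(552960·5 + 60) < 2.5·10⁷`. A datum over the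
typed SIGNATURE (nothing of the arithmetic of any curve). PROVED. [folklore] -/
theorem exists_mainBoundDatum_not_ineqE : ∃ M : MainBoundDatum,
    ¬ ((1 / 6 - 2 / ((M.ell : ℝ) * ((M.ell : ℝ) + 1))) * M.logq ≤
      (1 + 4 / (M.ell : ℝ)) * M.logDiffLp + 8 * (M.dmod : ℝ) / M.ell * (M.logDiffLtpd + M.logCondLtpd)
        + 4 / (M.ell : ℝ) * Real.log (2 * 3 * 5 * (M.ell : ℝ)) + 80 / 9 * ((M.estar : ℝ) * M.ell + 60)) := by
  refine ⟨{
      ell := 5, ell_prime := Nat.prime_five, five_le_ell := le_rfl, dmod := 1, one_le_dmod := le_rfl, emod := 1,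
      one_le_emod := le_rfl, emod_le_dmod := le_rfl, logq := 10 ^ 9, logq_pos := (by norm_num), logDiffLtpd := 0,
      logDiffLtpd_nonneg := le_rfl, logCondLtpd := 0, logCondLtpd_nonneg := le_rfl, logDiffL := 0, logDiffL_nonneg := le_rfl,
      logCondL := 0, logCondL_nonneg := le_rfl, logDiffLp := 0, logDiffLp_nonneg := le_rfl, logCondLp := 0,
      logCondLp_nonneg := le_rfl, degLLtpd := 1, one_le_degLLtpd := le_rfl, degLpL := 1, one_le_degLpL := le_rfl }, ?_⟩
  have hlog : Real.log (2 * 3 * 5 * (5 : ℝ)) ≤ 150 := by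
    linarith [Real.log_le_sub_one_of_pos (show (0 : ℝ) < 2 * 3 * 5 * 5 by norm_num)]
  have hlog' : Real.log 150 ≤ 150 := by linarith [Real.log_le_sub_one_of_pos (show (0 : ℝ) < 150 by norm_num)]
  unfold MainBoundDatum.estar; dsimp only; push_cast
  intro h
  linarith [hlog, hlog']

/-- **Hence the nine-input block is UNSATISFIABLE at that datum** (E-t35's `exists_glue_inputs_iff`, p446138) — while by §2 every
eight-input sub-block is satisfiable at it: the eight non-idle inputs are an irredundant core on the free glued carrier. PROVED.
[claim: Joshi2024ATS4, status: disputed] -/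
theorem exists_mainBoundDatum_not_glue_inputs : ∃ M : MainBoundDatum,
    ¬ ∃ dd : LocusVolumeDatum, MainBoundGlue M dd ∧ dd.Eq6111 ∧ (∀ p ∈ dd.Vdst, dd.Prop6109 p) ∧ dd.ComponentSums ∧
      dd.Eq6811 ∧ dd.Lem678 ∧ dd.LowerBound ∧ dd.FrobShiftQ ∧ dd.FrobShiftVol ∧ dd.LogqDictionary := by
  obtain ⟨M, hM⟩ := exists_mainBoundDatum_not_ineqE
  exact ⟨M, fun h => hM (M.exists_glue_inputs_iff.1 h)⟩

end MainBoundDatum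

end Summit.ABC.IUTFork.Joshi.ATS4

end
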